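import Summits.QuantumFields.YangMills.Theorems.BalabanLadderUVSeamRecCeilingsWindowCellLaws
import Summits.QuantumFields.YangMills.Theorems.BalabanLadderUVSeamRecCeilingsBlockFieldLocality
import Literature.Probability.LatticeModels.PSCornerEncoding
import HarnessLib

/-!
# Crux `UVSeamRec` (stmt-QuantumFields-20043), lane B: LEVEL SLICES for the linear-budget engine — level `0` in the exponential currency,
# Hölder over the sign classes of a reduced family, and the arithmetic of the depth below the top shell level

Helper file (`--supports stmt-QuantumFields-20043`) of the width-lever seat `ym-20043-ceilings-p2` (lane B, gen 8); companion of
`…CeilingsDLRPeelingExpWeights` (peeling of exponential weights: window family ⇒ `⟨exp(Σ t_γ 1_γ)⟩ ≤ exp((1/K)Σ(e^{Kt_γ} − 1)w)`), consumed by the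
level assembly `…CeilingsDLRPeelingLinearBudget`.

THE POINT.  g3's level assembly (`…ResponseCarriersLevelwise`) runs Hölder across the levels with exponents `p_k ∝ 1/Λ_k` (`Λ_k` the level cap of
the per-polymer coefficient, g3 `sum_sum_fiber_familyCoeff_le_levelCap`), so every level is driven at the top level's strength and the per-level
laws must be PRODUCT LAWS — whence thinning and the roots `δ^{1/16}` (sign classes) and `w^{1/(16K)}` (g6/g7's (UCR) chain, `K = 256(2m+4)⁴`).
Here the exponents are GEOMETRIC in the depth below the top shell level `k_top` (`2b^{k_top} ≤ R`): `p = 2^{j+1}` at level `k = k_top − j`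
(`Σ_j 2^{−(j+1)} ≤ 1`, the slack carried by a dummy slot).  Since `Λ_{k_top−j} ≤ b^{−4j}`, the exponential weight seen by the level-`k` peeling is
`16K·2^{j+2}·b^{−4j} ≤ 64K(2/b⁴)^j ≤ 1` as soon as `j ≥ m + 4` (`b ≥ 3`), and there `e^x − 1 ≤ (e−1)x` makes the level's Hölder constant
`2(e−1)·1536·w_k·#T` — LINEAR in the (UCR) weight `w_k` (per-level coefficient mass `1536`, tempered-d1 `sum_influenceCoeff_level_le`); the `≤ m+4`
top levels are bounded TRIVIALLY by their coefficient mass (`3072·#T` each; they include g7's non-fitting levels); level `0`, when deep, runs on the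
PROVED period-free plaquette law (`torusE_prod_indicator_levelZero_le`) in the same exponential currency.
* §1 `torusE_exp_sum_indicator_levelZero_le` (level-`0` window families: `⟨exp(Σ t_γ1_γ)⟩ ≤ exp(Σ(e^{t_γ} − 1)δ₀)`).
* §2 `torusE_exp_sum_le_of_signClasses` — Hölder over the 16 sign classes of the level-`k` slice of the family shell of a REDUCED family: a
  window-family law with constant `K'` gives the slice law with constant `16K'`.
* §3 arithmetic of the depth: `levelCap_le_inv_pow`, `deep_fits`, `deep_small`.
* (sequel `…CeilingsDLRPeelingLinearBudget`: `torusE_exp_two_mul_sum_influence_le_of_uniformConditionalRarity_linear` —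
  `⟨exp(2Σ_{i∈T} influence∘lift)⟩_{2L+1,β} ≤ exp((3072(m+4) + 2(e−1)·1536·(δ₀(β) + Σ_{1≤k≤kmax} w_k))·#T)` versus g7's
  `exp(2e²·1536·(δ₀ + Σ_k w_k^{1/(16K)} + m)·#T)`.)
HONEST FRAMING.  Folklore probability (DLR peeling, Hölder); (UCR_k) is the OPEN one-box large-field input (Bałaban's R-operation currency with
Dirichlet data; classical consistency `ε(β,k) ≳ π⁴/(2(2m+1)⁴)`, `m` free); nothing of E0′; not a gap, not Clay.
References: folklore; T. Bałaban, Commun. Math. Phys. 122 (1989) 355–392 (intended supplier of (UCR_k): `Σ_j exp(−p₀(g_j))`-type budgets).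
-/

set_option autoImplicit false

noncomputable section

open MeasureTheory Filter Topology Finset
open Literature.Probability.LatticeModels
open Literature.MathematicalPhysics.QuantumFieldTheory (GaugeConfig wilsonMeasure LatticeRep isProbabilityMeasure_wilsonMeasure
  measurable_torusLift)
open Literature.MathematicalPhysics.QuantumLattice (LGConfig torusLift IsCylinder ymSpecification isProbabilityMeasure_ymSpecification
  integrable_of_abs_le fundamentalLatticeRep)

namespace Summit.QuantumFields.YangMills.Cruxes.UVSeamRec.DLRPeeling

open Summit.QuantumFields.YangMills.Cruxes.OSLegsFromFemtoAndGap.DlrCollarTransfer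
open Summit.QuantumFields.YangMills.Cruxes.UVSeamRec.PolymerData
open Summit.QuantumFields.YangMills.Cruxes.UVSeamRec.TemperedResponse
open Summit.QuantumFields.YangMills.Cruxes.UVSeamRec.DefectCollar (integral_prod_indicator_eq_measureReal)
open Summit.QuantumFields.YangMills.Theorems.OddTorusChessboard (Orient)

/-! ## §1 Level `0` in the exponential currency -/

section LevelZero

variable {N : ℕ} [NeZero N]

/-- **Level `0` in the exponential currency.**  With the constants `K₀, D₁` of the PROVED period-free plaquette law
(`TemperedResponse.torusE_prod_indicator_levelZero_le`, p553454) and `δ₀(β) = exp(−βNε₀/#Orient + (K₀ + D₁ log β)/#Orient)`: fundamental `SU(N)`,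
odd torus `2L+1` (`L ≥ 1`), `β ≥ 1`; for every finite family `A` of level-`0` polymers (plaquettes) whose anchors fit in one period window
`[o, o+2L+1)⁴` (so that `A` is period-free) and coefficients `t_γ ≥ 0`:
`⟨exp(Σ_{γ∈A} t_γ·1_{largeFieldEvent 𝔟 ε₀ γ}∘lift)⟩_{2L+1,β} ≤ exp(Σ_{γ∈A} (e^{t_γ} − 1)·δ₀(β))` — product law ⇒ exponential moments by the
ideal-gas expansion (p527372 `PolymerRarity.integral_exp_sum_indicator_le_prod`). [folklore] -/
theorem torusE_exp_sum_indicator_levelZero_le :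
    ∃ K₀ : ℝ, ∃ D₁ : ℕ, ∀ (𝔟 : BlockSize) (ε₀ : ℝ) (L : ℕ), 1 ≤ L → ∀ β : ℝ, 1 ≤ β →
      ∀ (o : Fin 4 → ℤ) (A : Finset Polymer), (∀ γ ∈ A, γ.k = 0) →
        (∀ γ ∈ A, ∀ c, o c ≤ anchor 𝔟 γ c ∧ anchor 𝔟 γ c + (𝔟.b : ℤ) ^ (0 : ℕ) ≤ o c + (2 * L + 1)) →
        ∀ t : Polymer → ℝ, (∀ γ ∈ A, 0 ≤ t γ) →
        torusE (Matrix.specialUnitaryGroup (Fin N) ℂ) (fundamentalLatticeRep N) β L (fun U => Real.exp (∑ γ ∈ A,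
          t γ * (largeFieldEvent (N := N) 𝔟 ε₀ γ).indicator (fun _ => (1 : ℝ)) U)) ≤
          Real.exp (∑ γ ∈ A, (Real.exp (t γ) - 1) * Real.exp (-(β * ((N : ℝ) * ε₀)) / Fintype.card (Orient 4) +
            (K₀ + D₁ * Real.log β) / Fintype.card (Orient 4))) := by
  classical
  obtain ⟨K₀, D₁, hPL0⟩ := torusE_prod_indicator_levelZero_le (N := N)
  refine ⟨K₀, D₁, ?_⟩
  intro 𝔟 ε₀ L hL β hβ o A hA0 hwin t ht
  haveI := isProbabilityMeasure_wilsonMeasure (d := 4) (L := 2 * L + 1) (fundamentalLatticeRep N).ρ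
    (fundamentalLatticeRep N).continuous β
  set δ₀ : ℝ := Real.exp (-(β * ((N : ℝ) * ε₀)) / Fintype.card (Orient 4) + (K₀ + D₁ * Real.log β) / Fintype.card (Orient 4))
    with hδ₀def
  have hδ₀0 : 0 ≤ δ₀ := (Real.exp_pos _).le
  -- a window family of level `0` is period-free
  have hinjA : ∀ B ⊆ A, Set.InjOn (fun γ : Polymer => (γ.k, Torus.proj (2 * L + 1) (anchor 𝔟 γ), γ.μ, γ.ν)) ↑B := by
    intro B hB γ hγ γ' hγ' heq
    have hγA := hB hγ
    have hγ'A := hB hγ'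
    simp only [Prod.mk.injEq] at heq
    obtain ⟨hk, hproj, hμ, hν⟩ := heq
    have hy : γ.y = γ'.y := by
      funext c
      have hc : (Torus.proj (2 * L + 1) (anchor 𝔟 γ)) c = (Torus.proj (2 * L + 1) (anchor 𝔟 γ')) c := by rw [hproj]
      simp only [Torus.proj_apply] at hc
      have hdvd : ((2 * L + 1 : ℕ) : ℤ) ∣ anchor 𝔟 γ' c - anchor 𝔟 γ c := (ZMod.intCast_eq_intCast_iff_dvd_sub _ _ _).1 hc
      have h1 := hwin γ hγA c
      have h2 := hwin γ' hγ'A c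
      have hk0 : γ.k = 0 := hA0 γ hγA
      have hk0' : γ'.k = 0 := hA0 γ' hγ'A
      simp only [anchor, hk0, hk0', pow_zero, one_mul] at h1 h2 hdvd ⊢
      have hlt : |γ'.y c - γ.y c| < (2 * L + 1 : ℕ) := by
        rw [abs_lt]; push_cast; constructor <;> linarith
      have h0 := Int.eq_zero_of_abs_lt_dvd hdvd (by exact_mod_cast hlt)
      linarith
    obtain ⟨k₁, y₁, μ₁, ν₁, h₁⟩ := γ
    obtain ⟨k₂, y₂, μ₂, ν₂, h₂⟩ := γ'
    simp only at hk hμ hν hy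
    subst hk; subst hμ; subst hν; subst hy
    rfl
  -- the product law for every subfamily, in `μ.real` form
  set μT := wilsonMeasure (d := 4) (L := 2 * L + 1) (fundamentalLatticeRep N).ρ β with hμT
  set E' : Polymer → Set (GaugeConfig 4 (2 * L + 1) (Matrix.specialUnitaryGroup (Fin N) ℂ)) := fun γ =>
    (torusLift (2 * L + 1)) ⁻¹' largeFieldEvent (N := N) 𝔟 ε₀ γ with hE'
  have hE'm : ∀ γ, MeasurableSet (E' γ) := fun γ =>
    measurableSet_preimage (measurable_torusLift _) (measurableSet_largeFieldEvent (N := N) 𝔟 ε₀ γ)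
  have hind : ∀ γ (U : GaugeConfig 4 (2 * L + 1) (Matrix.specialUnitaryGroup (Fin N) ℂ)),
      (E' γ).indicator (fun _ => (1 : ℝ)) U = (largeFieldEvent (N := N) 𝔟 ε₀ γ).indicator (fun _ => (1 : ℝ)) (torusLift (2 * L + 1) U) := by
    intro γ U
    simp only [hE', Set.indicator_apply, Set.mem_preimage]
  have hPL : ∀ B, B ⊆ A → μT.real (⋂ γ ∈ B, E' γ) ≤ ∏ _γ ∈ B, δ₀ := by
    intro B hB
    have hlaw := hPL0 𝔟 ε₀ L hL β hβ B (fun γ hγ => hA0 γ (hB hγ)) (hinjA B hB)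
    have hset : μT.real (⋂ γ ∈ B, E' γ) = ∫ U, ∏ γ ∈ B, (E' γ).indicator (fun _ => (1 : ℝ)) U ∂μT :=
      (integral_prod_indicator_eq_measureReal μT B E' hE'm).symm
    rw [hset]
    have : ∫ U, ∏ γ ∈ B, (E' γ).indicator (fun _ => (1 : ℝ)) U ∂μT =
        torusE (Matrix.specialUnitaryGroup (Fin N) ℂ) (fundamentalLatticeRep N) β L (fun U => ∏ γ ∈ B,
          (largeFieldEvent (N := N) 𝔟 ε₀ γ).indicator (fun _ => (1 : ℝ)) U) := by
      unfold torusE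
      exact integral_congr_ae (ae_of_all _ fun U => Finset.prod_congr rfl fun γ _ => hind γ U)
    rw [this]
    simpa only [hδ₀def] using hlaw
  have key := PolymerRarity.integral_exp_sum_indicator_le_prod μT A E' hE'm t (fun _ => δ₀) ht hPL
  have hlhs : torusE (Matrix.specialUnitaryGroup (Fin N) ℂ) (fundamentalLatticeRep N) β L (fun U => Real.exp (∑ γ ∈ A,
      t γ * (largeFieldEvent (N := N) 𝔟 ε₀ γ).indicator (fun _ => (1 : ℝ)) U)) =
      ∫ U, Real.exp (∑ γ ∈ A, t γ * (E' γ).indicator (fun _ => (1 : ℝ)) U) ∂μT := by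
    unfold torusE
    exact integral_congr_ae (ae_of_all _ fun U => by simp only [hind])
  rw [hlhs]
  refine key.trans ?_
  calc ∏ γ ∈ A, (1 + (Real.exp (t γ) - 1) * δ₀) ≤ ∏ γ ∈ A, Real.exp ((Real.exp (t γ) - 1) * δ₀) := by
        refine Finset.prod_le_prod (fun γ hγ => ?_) fun γ hγ => ?_
        · have : 0 ≤ (Real.exp (t γ) - 1) * δ₀ := mul_nonneg (by linarith [Real.one_le_exp (ht γ hγ)]) hδ₀0
          linarith
        · have := Real.add_one_le_exp ((Real.exp (t γ) - 1) * δ₀)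
          linarith
    _ = Real.exp (∑ γ ∈ A, (Real.exp (t γ) - 1) * δ₀) := by rw [Real.exp_sum]

end LevelZero

/-! ## §2 Hölder over the 16 sign classes of a level slice of the family shell of a reduced family -/

section SignClasses

variable {N : ℕ} [NeZero N]

/-- **FROM A WINDOW-FAMILY LAW TO THE LEVEL SLICE OF A REDUCED FAMILY, AT THE COST `K' ↦ 16K'` INSIDE THE WEIGHT.**  Fundamental `SU(N)`, odd torus
`2L+1`, any `β`; a REDUCED cube family (`|x i c| ≤ L`) with `4R+8 ≤ L`; block size `𝔟`, cutoff `kmax`, threshold `ε`, level `k`; a constant `K' > 0`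
and a weight `θ` with the window-family law at level `k`: for every window origin `o`, every family `A` of level-`k` members of the family shell
whose blocks fit in `[o, o+2L+1)⁴` and all coefficients `t_γ ≥ 0`, `⟨exp(Σ_{γ∈A} t_γ 1_γ∘lift)⟩ ≤ exp((1/K')Σ_{γ∈A}(e^{K't_γ} − 1)θ)`.  Then for every
family `S` of level-`k` members of the family shell and `t_γ ≥ 0`:
`⟨exp(Σ_{γ∈S} t_γ 1_γ∘lift)⟩ ≤ exp((1/(16K'))Σ_{γ∈S}(e^{16K't_γ} − 1)θ)` — split `S` into its 16 sign classes (each fits in one period window,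
g3 `anchor_window_of_signClass`) and combine them by Hölder with all exponents `16`. [folklore] -/
theorem torusE_exp_sum_le_of_signClasses (β : ℝ) (𝔟 : BlockSize) (ε : ℝ) (kmax R L k : ℕ) (hRL : 4 * R + 8 ≤ L)
    {n : ℕ} (x : Fin n → (Fin 4 → ℤ)) (hred : ∀ i c, |x i c| ≤ (L : ℤ)) {K' θ : ℝ} (hK' : 0 < K')
    (hWF : ∀ (o : Fin 4 → ℤ) (A : Finset Polymer), A ⊆ familyShell 𝔟 kmax R x → (∀ γ ∈ A, γ.k = k) →
      (∀ γ ∈ A, ∀ c, o c ≤ anchor 𝔟 γ c ∧ anchor 𝔟 γ c + (𝔟.b : ℤ) ^ k ≤ o c + (2 * L + 1)) →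
      ∀ t : Polymer → ℝ, (∀ γ ∈ A, 0 ≤ t γ) →
      torusE (Matrix.specialUnitaryGroup (Fin N) ℂ) (fundamentalLatticeRep N) β L (fun U => Real.exp (∑ γ ∈ A,
        t γ * (largeFieldEvent (N := N) 𝔟 ε γ).indicator (fun _ => (1 : ℝ)) U)) ≤
        Real.exp (1 / K' * ∑ γ ∈ A, (Real.exp (K' * t γ) - 1) * θ))
    (S : Finset Polymer) (hS : S ⊆ familyShell 𝔟 kmax R x) (hSk : ∀ γ ∈ S, γ.k = k)
    (t : Polymer → ℝ) (ht : ∀ γ ∈ S, 0 ≤ t γ) :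
    torusE (Matrix.specialUnitaryGroup (Fin N) ℂ) (fundamentalLatticeRep N) β L (fun U => Real.exp (∑ γ ∈ S,
        t γ * (largeFieldEvent (N := N) 𝔟 ε γ).indicator (fun _ => (1 : ℝ)) U)) ≤
      Real.exp (1 / (16 * K') * ∑ γ ∈ S, (Real.exp (16 * K' * t γ) - 1) * θ) := by
  classical
  haveI := isProbabilityMeasure_wilsonMeasure (d := 4) (L := 2 * L + 1) (fundamentalLatticeRep N).ρ
    (fundamentalLatticeRep N).continuous β
  let sgn : Polymer → (Fin 4 → Bool) := fun γ c => decide (0 ≤ anchor 𝔟 γ c)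
  let cls : (Fin 4 → Bool) → Finset Polymer := fun s => S.filter fun γ => sgn γ = s
  let χ : Polymer → LGConfig 4 (Matrix.specialUnitaryGroup (Fin N) ℂ) → ℝ := fun γ U =>
    (largeFieldEvent (N := N) 𝔟 ε γ).indicator (fun _ => (1 : ℝ)) U
  have hχ01 : ∀ γ (U : LGConfig 4 (Matrix.specialUnitaryGroup (Fin N) ℂ)), 0 ≤ χ γ U ∧ χ γ U ≤ 1 := fun γ U =>
    ⟨Set.indicator_nonneg (fun _ _ => zero_le_one) _, Set.indicator_apply_le' (fun _ => le_rfl) (fun _ => zero_le_one)⟩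
  have hχm : ∀ γ, Measurable (χ γ) := fun γ => measurable_const.indicator (measurableSet_largeFieldEvent (N := N) 𝔟 ε γ)
  have h16 : (Fintype.card (Fin 4 → Bool) : ℝ) = 16 := by simp
  -- per sign class: the window-family law with coefficients `16 t`
  have hclass : ∀ s, ∫ U, Real.exp (16 * ∑ γ ∈ cls s, t γ * χ γ (torusLift (2 * L + 1) U))
      ∂(wilsonMeasure (d := 4) (L := 2 * L + 1) (fundamentalLatticeRep N).ρ β) ≤
      Real.exp (16 * (1 / (16 * K') * ∑ γ ∈ cls s, (Real.exp (16 * K' * t γ) - 1) * θ)) := by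
    intro s
    have hcS : cls s ⊆ S := Finset.filter_subset _ _
    set o : Fin 4 → ℤ := fun c => if s c then (0 : ℤ) else -((L : ℤ) + 2 * R + 2) with ho
    have hwin : ∀ γ ∈ cls s, ∀ c, o c ≤ anchor 𝔟 γ c ∧ anchor 𝔟 γ c + (𝔟.b : ℤ) ^ k ≤ o c + (2 * L + 1) := by
      intro γ hγ c
      have h1 := Finset.mem_filter.1 hγ
      have hγk : γ.k = k := hSk γ h1.1
      have hw := anchor_window_of_signClass 𝔟 kmax R L hRL x hred (hS h1.1) s h1.2 c
      rw [hγk] at hw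
      simpa only [ho] using hw
    have h := hWF o (cls s) (hcS.trans hS) (fun γ hγ => hSk γ (hcS hγ)) hwin (fun γ => 16 * t γ)
      (fun γ hγ => mul_nonneg (by norm_num) (ht γ (hcS hγ)))
    have e1 : 16 * (1 / (16 * K') * ∑ γ ∈ cls s, (Real.exp (16 * K' * t γ) - 1) * θ) =
        1 / K' * ∑ γ ∈ cls s, (Real.exp (K' * (16 * t γ)) - 1) * θ := by
      rw [← mul_assoc, show (16 : ℝ) * (1 / (16 * K')) = 1 / K' by field_simp]
      refine congrArg _ (Finset.sum_congr rfl fun γ _ => by ring_nf)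
    rw [e1]
    refine (le_of_eq ?_).trans h
    unfold torusE
    refine integral_congr_ae (ae_of_all _ fun U => ?_)
    simp only [χ, Finset.mul_sum]
    refine congrArg Real.exp (Finset.sum_congr rfl fun γ _ => by ring)
  have key := PolymerRarity.integral_exp_sum_le_exp_sum_of_holder
    (wilsonMeasure (d := 4) (L := 2 * L + 1) (fundamentalLatticeRep N).ρ β) (Finset.univ : Finset (Fin 4 → Bool))
    (fun s U => ∑ γ ∈ cls s, t γ * χ γ (torusLift (2 * L + 1) U))
    (fun s _ => Finset.measurable_sum _ fun γ _ => ((hχm γ).comp (measurable_torusLift _)).const_mul _)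
    (fun s => ∑ γ ∈ cls s, t γ)
    (fun s _ U => by
      have hcS : cls s ⊆ S := Finset.filter_subset _ _
      rw [abs_of_nonneg (Finset.sum_nonneg fun γ hγ => mul_nonneg (ht γ (hcS hγ)) (hχ01 γ _).1)]
      exact Finset.sum_le_sum fun γ hγ => by
        simpa using mul_le_mul_of_nonneg_left (hχ01 γ (torusLift (2 * L + 1) U)).2 (ht γ (hcS hγ)))
    (fun _ => 16) (fun s => 1 / (16 * K') * ∑ γ ∈ cls s, (Real.exp (16 * K' * t γ) - 1) * θ) (fun _ _ => by norm_num)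
    (by rw [Finset.sum_const, Finset.card_univ, nsmul_eq_mul, h16]; norm_num)
    (fun s _ => hclass s)
  have hsumF : ∀ U : GaugeConfig 4 (2 * L + 1) (Matrix.specialUnitaryGroup (Fin N) ℂ),
      ∑ s, ∑ γ ∈ cls s, t γ * χ γ (torusLift (2 * L + 1) U) = ∑ γ ∈ S, t γ * χ γ (torusLift (2 * L + 1) U) := fun U =>
    Finset.sum_fiberwise S sgn fun γ => t γ * χ γ (torusLift (2 * L + 1) U)
  have hsumC : ∑ s, 1 / (16 * K') * ∑ γ ∈ cls s, (Real.exp (16 * K' * t γ) - 1) * θ =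
      1 / (16 * K') * ∑ γ ∈ S, (Real.exp (16 * K' * t γ) - 1) * θ := by
    rw [← Finset.mul_sum, Finset.sum_fiberwise S sgn fun γ => (Real.exp (16 * K' * t γ) - 1) * θ]
  unfold torusE
  simp only [hsumF] at key
  rw [hsumC] at key
  exact key

end SignClasses

/-! ## §3 Arithmetic of the depth below the top shell level -/

section Depth

/-- **The level cap decays geometrically below the top shell level**: if `2b^K ≤ R` and `k + j = K` then
`16·(b^k/(R+2+2b^k))⁴ ≤ (b⁴)^{−j}` (`R + 2 + 2b^k ≥ 2b^K = 2b^k·b^j`). [folklore] -/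
theorem levelCap_le_inv_pow (𝔟 : BlockSize) {R K k j : ℕ} (hK : 2 * 𝔟.b ^ K ≤ R) (hkj : k + j = K) :
    16 * ((𝔟.b : ℝ) ^ k / ((R : ℝ) + 2 + 2 * (𝔟.b : ℝ) ^ k)) ^ 4 ≤ 1 / ((𝔟.b : ℝ) ^ 4) ^ j := by
  have hb : (0 : ℝ) < (𝔟.b : ℝ) := by exact_mod_cast 𝔟.pos
  have hbk : (0 : ℝ) < (𝔟.b : ℝ) ^ k := by positivity
  have hbj : (0 : ℝ) < (𝔟.b : ℝ) ^ j := by positivity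
  have hden : (0 : ℝ) < (R : ℝ) + 2 + 2 * (𝔟.b : ℝ) ^ k := by positivity
  have hKR : 2 * (𝔟.b : ℝ) ^ K ≤ R := by exact_mod_cast hK
  have hpow : (𝔟.b : ℝ) ^ K = (𝔟.b : ℝ) ^ k * (𝔟.b : ℝ) ^ j := by rw [← pow_add, hkj]
  have hratio : (𝔟.b : ℝ) ^ k / ((R : ℝ) + 2 + 2 * (𝔟.b : ℝ) ^ k) ≤ 1 / (2 * (𝔟.b : ℝ) ^ j) := by
    rw [div_le_div_iff₀ hden (by positivity)]
    nlinarith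
  have h0 : 0 ≤ (𝔟.b : ℝ) ^ k / ((R : ℝ) + 2 + 2 * (𝔟.b : ℝ) ^ k) := by positivity
  calc 16 * ((𝔟.b : ℝ) ^ k / ((R : ℝ) + 2 + 2 * (𝔟.b : ℝ) ^ k)) ^ 4
      ≤ 16 * (1 / (2 * (𝔟.b : ℝ) ^ j)) ^ 4 := by gcongr
    _ = 1 / ((𝔟.b : ℝ) ^ 4) ^ j := by
        rw [div_pow, mul_pow, ← pow_mul, ← pow_mul, show j * 4 = 4 * j by ring]
        norm_num
        field_simp

/-- `2m + 4 ≤ 2^{m+1}` for `m ≥ 3`. [folklore] -/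
theorem two_mul_add_four_le_two_pow {m : ℕ} (hm : 3 ≤ m) : 2 * m + 4 ≤ 2 ^ (m + 1) := by
  induction m, hm using Nat.le_induction with
  | base => norm_num
  | succ m hm ih =>
    calc 2 * (m + 1) + 4 = (2 * m + 4) + 2 := by ring
      _ ≤ 2 ^ (m + 1) + 2 ^ (m + 1) := add_le_add ih (by
          calc (2 : ℕ) = 2 ^ 1 := by norm_num
            _ ≤ 2 ^ (m + 1) := Nat.pow_le_pow_right (by norm_num) (by omega))
      _ = 2 ^ (m + 1 + 1) := by ring

/-- **Deep levels carry small exponential weights**: for `b ≥ 3`, `m ≥ 3` and depth `j ≥ m + 4`,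
`64·(256(2m+4)⁴)·(2/b⁴)^j ≤ 1` (`2/b⁴ ≤ 1/32`, `2m+4 ≤ 2^{m+1}`: the left side is `≤ 2^{4m+18−5j} ≤ 2^{−m−2}`). [folklore] -/
theorem deep_small (𝔟 : BlockSize) {m j : ℕ} (hm : 3 ≤ m) (hj : m + 4 ≤ j) :
    64 * (256 * (2 * (m : ℝ) + 4) ^ 4) * (2 / (𝔟.b : ℝ) ^ 4) ^ j ≤ 1 := by
  have hb3 : (3 : ℝ) ≤ (𝔟.b : ℝ) := by exact_mod_cast BlockFieldLocality.three_le_b 𝔟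
  have hb4 : (81 : ℝ) ≤ (𝔟.b : ℝ) ^ 4 := by
    have h := pow_le_pow_left₀ (by norm_num : (0 : ℝ) ≤ 3) hb3 4
    norm_num at h
    exact h
  have hq : 2 / (𝔟.b : ℝ) ^ 4 ≤ 1 / 32 := by
    rw [div_le_div_iff₀ (by positivity) (by norm_num)]; linarith
  have hq0 : 0 ≤ 2 / (𝔟.b : ℝ) ^ 4 := by positivity
  have hm' : (2 * (m : ℝ) + 4) ≤ (2 : ℝ) ^ (m + 1) := by exact_mod_cast two_mul_add_four_le_two_pow hm
  have hm0 : 0 ≤ 2 * (m : ℝ) + 4 := by positivity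
  -- reduce to powers of two
  have h1 : 64 * (256 * (2 * (m : ℝ) + 4) ^ 4) * (2 / (𝔟.b : ℝ) ^ 4) ^ j ≤
      64 * (256 * ((2 : ℝ) ^ (m + 1)) ^ 4) * (1 / 32) ^ (m + 4) := by
    have ha : (2 / (𝔟.b : ℝ) ^ 4) ^ j ≤ (1 / 32 : ℝ) ^ (m + 4) :=
      (pow_le_pow_left₀ hq0 hq j).trans (pow_le_pow_of_le_one (by norm_num) (by norm_num) hj)
    gcongr
  refine h1.trans ?_
  have e1 : (64 : ℝ) * (256 * ((2 : ℝ) ^ (m + 1)) ^ 4) = 2 ^ (4 * m + 18) := by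
    rw [← pow_mul, show (64 : ℝ) = 2 ^ 6 by norm_num, show (256 : ℝ) = 2 ^ 8 by norm_num, ← pow_add, ← pow_add,
      show 6 + (8 + (m + 1) * 4) = 4 * m + 18 by ring]
  have e2 : ((1 : ℝ) / 32) ^ (m + 4) = 1 / 2 ^ (5 * m + 20) := by
    rw [div_pow, one_pow, show (32 : ℝ) = 2 ^ 5 by norm_num, ← pow_mul, show 5 * (m + 4) = 5 * m + 20 by ring]
  rw [e1, e2, mul_one_div, div_le_one (by positivity)]
  exact pow_le_pow_right₀ (by norm_num) (by omega)

/-- **Deep levels fit in the torus.**  If `2b^K ≤ R`, `4R+8 ≤ L`, `k + j = K` and `j ≥ m + 4` (`m ≥ 3`), then the collar cube of side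
`(2m+1)b^k` fits: `(2m+1)b^k + 3 ≤ 2L+1` (`2m+1 ≤ 3^m ≤ b^j`, so `(2m+1)b^k ≤ b^K ≤ R/2`). [folklore] -/
theorem deep_fits (𝔟 : BlockSize) {m R L K k j : ℕ} (hK : 2 * 𝔟.b ^ K ≤ R) (hRL : 4 * R + 8 ≤ L)
    (hkj : k + j = K) (hj : m + 4 ≤ j) : (2 * m + 1) * 𝔟.b ^ k + 3 ≤ 2 * L + 1 := by
  have hb3 : 3 ≤ 𝔟.b := BlockFieldLocality.three_le_b 𝔟
  have h1 : 2 * m + 1 ≤ 3 ^ m := two_mul_add_one_le_three_pow m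
  have h2 : 3 ^ m ≤ 𝔟.b ^ m := Nat.pow_le_pow_left hb3 m
  have h3 : 𝔟.b ^ m ≤ 𝔟.b ^ j := Nat.pow_le_pow_right 𝔟.pos (by omega)
  have h4 : (2 * m + 1) * 𝔟.b ^ k ≤ 𝔟.b ^ K := by
    calc (2 * m + 1) * 𝔟.b ^ k ≤ 𝔟.b ^ j * 𝔟.b ^ k := Nat.mul_le_mul_right _ (h1.trans (h2.trans h3))
      _ = 𝔟.b ^ K := by rw [← pow_add, add_comm, hkj]
  omega

end Depth

end Summit.QuantumFields.YangMills.Cruxes.UVSeamRec.DLRPeeling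

end
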